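import Summits.ResolutionOfSingularities.ResolutionOfSingularities.Theorems.EquisingularLiftEquisingularLiftNatValuationChartCentre
import Summits.ResolutionOfSingularities.ResolutionOfSingularities.Theorems.EquisingularLiftEquisingularLiftNatRibbonBad
import Mathlib.RingTheory.Valuation.ValuationSubring
import HarnessLib

/-!
# [OURS · L1 W4.5(b) · EL♮] K-VAL-CENTRE-UNIQ (U-3b): EVERY point of the blowing up over a RIBBON touch whose local ring is
# dominated by the valuation ring is BAD — ambient frame, valuation with support, no chart chosen in advance
# (crux `EquisingularLiftNat` = stmt-ResolutionOfSingularities-20038; PARENT ≥ 4 band / kill test #50 K5-BMY, DSHARP-VOID §2 (2a))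

HONEST FRAMING. OURS (cell res-hironaka, crux chain w45b, slot W4.5(b)); NOT a statement of any manuscript; replaces the role of
NOTHING in the manuscript; AI-written, AI review is weaker than expert review. Helper `--supports stmt-ResolutionOfSingularities-20038
--as helper`. Piece (U-3b) of res-D-brk-4 g9's cut (2026-08-27T20:28:48Z) of object «(U) K-VAL-CENTRE-UNIQ» (res-L1-w45b-plan-1 RULING
20:06:38Z). Sequel of p563432 / p565158 / p568114 / p569464.

THE POINT. p565158 proved that after a ribbon touch at `s` ONE point of `X′` over `s` — the one under the centre prime `𝔓_v` of a chart
chosen by the minimal value — is BAD and `v`-dominated. Here the chart is NOT chosen: **every point `x′ ∈ X′` whose local ring is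
dominated by the valuation ring `V`** (a LOCAL homomorphism `G : 𝒪_{X′,x′} → V ⊆ K` restricting to `φ : 𝒪_{X,π x′} → K` along
`π^♯_{x′}` — the currency of the tree's `BlowupPointBranches.lean` / `KModel.IsCentre`, here for a valuation WITH SUPPORT,
`v = V.valuation ∘ φ`, `ker φ ≠ 0` allowed) **is BAD**, as soon as the touch at `π x′` is a RIBBON (`ϖ − g ∈ 𝔪²`, `g` in the stalk
ideal `(c)` of the centre, all `cᵢ ∈ 𝔪`) and `V(g) > V(cᵢ)` for SOME `i`. No uniqueness of the centre is needed: the tree's stalk chart at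
`x′` (`IsBlowup.exists_reesChart_stalk`: `𝒪_{X′,x′}` is a localisation of SOME `𝒪_{X,πx′}[J/c_j]` at a prime `𝔴` over `𝔪`) carries
the valuation `V.valuation ∘ G ∘ χ`, which is `≤ 1` (it lands in `V`), hence is THE chart valuation `w` of p563432
(`valuation_blowupAlgebra_unique`), `𝔴 = {w < 1} = 𝔓_v` (G local), the chart index has maximal value, `g/c_j ∈ 𝔴`, and the
K-RIBBON-BAD ring form `RibbonBad.algebraMap_mem_sq` (p557704) gives `ϖ ∈ 𝔴² ↦ 𝔪_{x′}²`.

CONSEQUENCE FOR DSHARP-VOID §2 (2a) IN THE AMBIENT FRAME. With `Y_j ⊂ P_j`, `v` a valuation ring `V ⊆ K(Y_j)` dominating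
`𝒪_{Y_j,y}`, `π : P_{j+1} → P_j` the blowing up of the ribbon centre and `j : Y_{j+1} → P_{j+1}` the strict transform over
`ρ : Y_{j+1} → Y_j` (`j ≫ π = ρ ≫ i`): THE `v`-centre `y′ ∈ Y_{j+1}` (tree `IsBlowup.exists_point_stalkEmb_mem` /
`eq_of_stalkEmb_factors`, local `G : 𝒪_{Y_{j+1},y′} → V`) gives the local `G ∘ j^♯_{y′} : 𝒪_{P_{j+1}, j y′} → V` over
`φ = (𝒪_{Y_j,y} ⊆ K(Y_j)) ∘ i^♯_y`, so by `bad_of_localHom` THE POINT `j(y′)` OF THE AMBIENT BLOW-UP UNDER THE `v`-CENTRE IS BAD —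
the sentence (2a) with badness read in `𝒪_{P_{j+1}}` as (2c) needs. (The composite bookkeeping `j^♯ ∘ π^♯ = ρ^♯ ∘ i^♯` on stalks is
the only step left to the reader/by hand; everything valuation-theoretic is in this theorem.)

References: [GortzWedhorn2020, (13.19), Prop. 13.96 (2)]; [StacksProject, Tag 0804]; [ZariskiSamuel1960, Ch. VI §5]; tree
`…Resolution/BlowupStalkCharts.lean` (`IsBlowup.exists_reesChart_stalk`), `…AffineBlowupAlgebra` (`reesChartEquiv`), `…NatRibbonBad`
(`RibbonBad.algebraMap_mem_sq`), `…NatBadLocus` (`varpiGerm_comp`), `…NatValuationChartCentre` (p563432).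
-/

set_option linter.dupNamespace false -- mandated namespace `Summit.<Summit>.<Problem>` of this single-conjunct summit

noncomputable section

universe v

open IsLocalRing IsLocalization
open CategoryTheory AlgebraicGeometry TopologicalSpace
open Literature.AlgebraicGeometry.Resolution
open AlgebraicGeometry.Scheme.IdealSheafData

namespace Summit.ResolutionOfSingularities.ResolutionOfSingularities.Cruxes.EquisingularLiftNat.Sections

namespace ValChartCentre

variable {X' X : Scheme.{0}} {π : X' ⟶ X} {J : X.IdealSheafData}

/-- **K-VAL-CENTRE-UNIQ (U-3b) — every `V`-dominated point over a ribbon touch is BAD.** Data: a blowing up `π : X′ → X` along `J`,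
a base `r : X → Spec O`, `ϖ ∈ O`; a point `x′ ∈ X′`; generators `c` of `J_{π x′}`, all in `𝔪_{π x′}`; a member `g ∈ (c)` with
`ϖ_{π x′} − g ∈ 𝔪²` (RIBBON touch at `π x′`); a field `K`, a ring map `φ : 𝒪_{X,π x′} → K` and a valuation ring `V ⊆ K` with
`φ(𝒪_{X,π x′}) ⊆ V` CENTRED at `𝔪` (`t ∈ 𝔪 ↔ V(φ t) < 1`) and `V(φ g) < V(φ cᵢ)` for some `i`; and a LOCAL homomorphism
`G : 𝒪_{X′,x′} → V` with `G ∘ π^♯_{x′} = φ` (in `K`). THEN `x′` is BAD: the germ of `ϖ` at `x′` (w.r.t. `π ≫ r`) lies in `𝔪_{x′}²`.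
OURS. [folklore] -/
theorem bad_of_localHom {O : Type} [CommRing O] (r : X ⟶ Spec (.of O)) (ϖ : O)
    (hπ : IsBlowup π J) (x' : X') {k : ℕ} (c : Fin k → X.presheaf.stalk (π x'))
    (hc : Ideal.span (Set.range c) = stalkIdeal J (π x')) (hc𝔪 : ∀ i, c i ∈ maximalIdeal (X.presheaf.stalk (π x')))
    {g : X.presheaf.stalk (π x')} (hg : g ∈ Ideal.span (Set.range c))
    (hrib : (X.presheaf.Γgerm (π x')).hom (r.appTop.hom ((Scheme.ΓSpecIso (.of O)).inv.hom ϖ)) - g ∈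
      (maximalIdeal (X.presheaf.stalk (π x'))) ^ 2)
    {K : Type} [Field K] (φ : X.presheaf.stalk (π x') →+* K) (V : ValuationSubring K)
    (hV : ∀ t, φ t ∈ V) (hcent : ∀ t, t ∈ maximalIdeal (X.presheaf.stalk (π x')) ↔ V.valuation (φ t) < 1)
    (hvg : ∃ i, V.valuation (φ g) < V.valuation (φ (c i)))
    (G : X'.presheaf.stalk x' →+* V) [hGloc : IsLocalHom G] (hG : ∀ t, (G ((π.stalkMap x').hom t) : K) = φ t) :
    (X'.presheaf.Γgerm x').hom ((π ≫ r).appTop.hom ((Scheme.ΓSpecIso (.of O)).inv.hom ϖ)) ∈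
      (maximalIdeal (X'.presheaf.stalk x')) ^ 2 := by
  -- the valuation `v = V.valuation ∘ φ` on `R = 𝒪_{X,π x′}`
  let v : Valuation (X.presheaf.stalk (π x')) V.ValueGroup := V.valuation.comap φ
  have hvφ : ∀ t, v t = V.valuation (φ t) := fun t => rfl
  have hR : ∀ t, v t ≤ 1 := fun t => V.valuation_le_one ⟨φ t, hV t⟩
  have hcent' : ∀ t, v t < 1 ↔ t ∈ maximalIdeal (X.presheaf.stalk (π x')) := fun t => (hcent t).symm
  -- the tree's stalk chart at `x′`: `𝒪_{X′,x′} = (B_j)_𝔴`, `χ ∘ chartBase = π^♯`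
  obtain ⟨j, 𝔴, χ, hχ, hloc, -⟩ := hπ.exists_reesChart_stalk x' c hc
  letI := χ.toAlgebra
  haveI := hloc
  -- move to the image model `R[J/c_j]`
  let ε : chartRing c j ≃+* blowupAlgebra (Ideal.span (Set.range c)) (c j) :=
    reesChartEquiv (I := Ideal.span (Set.range c)) (c j) (Ideal.mem_span_range_self (f := c) (x := j))
  have hε : ∀ a, ε (chartBase c j a) = algebraMap _ (blowupAlgebra (Ideal.span (Set.range c)) (c j)) a :=
    reesChartEquiv_reesChartBase (c j) _
  let θ : blowupAlgebra (Ideal.span (Set.range c)) (c j) →+* X'.presheaf.stalk x' := χ.comp ε.symm.toRingHom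
  have hθz : ∀ z, θ z = χ (ε.symm z) := fun z => rfl
  have hθ : ∀ t : X.presheaf.stalk (π x'),
      θ (algebraMap _ (blowupAlgebra (Ideal.span (Set.range c)) (c j)) t) = (π.stalkMap x').hom t := by
    intro t
    rw [hθz, ← hε, RingEquiv.symm_apply_apply, hχ]
  -- `θ` detects the maximal ideal: `θ z ∈ 𝔪_{x′} ↔ ε⁻¹ z ∈ 𝔴`
  have hθmax : ∀ z : blowupAlgebra (Ideal.span (Set.range c)) (c j),
      θ z ∈ maximalIdeal (X'.presheaf.stalk x') ↔ ε.symm z ∈ 𝔴.asIdeal := by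
    intro z
    rw [hθz]
    exact IsLocalization.AtPrime.to_map_mem_maximal_iff (X'.presheaf.stalk x') 𝔴.asIdeal (ε.symm z)
  -- the valuation `wB = V.valuation ∘ G ∘ θ` on `R[J/c_j]`: it is `≤ 1`, extends `v`, and `θ⁻¹ 𝔪 = {wB < 1}`
  let wB : Valuation (blowupAlgebra (Ideal.span (Set.range c)) (c j)) V.ValueGroup :=
    V.valuation.comap ((V.subtype.comp G).comp θ)
  have hwB : ∀ z, wB z = V.valuation (G (θ z) : K) := fun z => rfl
  have hwB1 : ∀ z, wB z ≤ 1 := fun z => V.valuation_le_one (G (θ z))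
  have hwBalg : ∀ t : X.presheaf.stalk (π x'),
      wB (algebraMap _ (blowupAlgebra (Ideal.span (Set.range c)) (c j)) t) = v t := by
    intro t
    rw [hwB, hθ, hG, hvφ]
  have hwBlt : ∀ z, wB z < 1 ↔ θ z ∈ maximalIdeal (X'.presheaf.stalk x') := by
    intro z
    rw [hwB, ← ValuationSubring.valuation_lt_one_iff, IsLocalRing.mem_maximalIdeal, IsLocalRing.mem_maximalIdeal,
      mem_nonunits_iff, mem_nonunits_iff]
    constructor
    · intro h hu
      exact h (hu.map G)
    · intro h hu
      exact h (hGloc.map_nonunit _ hu)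
  -- the chart index has maximal (nonzero) value and `v g < v (c j)`
  obtain ⟨i₀, hi₀⟩ := hvg
  have hquot : ∀ i, wB ⟨algebraMap (X.presheaf.stalk (π x')) (Localization.Away (c j)) (c i) * Away.invSelf (c j),
      div_mem_blowupAlgebra _ _ (Ideal.subset_span ⟨i, rfl⟩)⟩ * v (c j) = v (c i) := by
    intro i
    rw [← hwBalg (c j), ← Valuation.map_mul, ← hwBalg (c i)]
    congr 1
    exact Subtype.ext (div_mul_algebraMap (c j) (c i))
  have ha : v (c j) ≠ 0 := by
    intro h0
    have h1 := hquot i₀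
    rw [h0, mul_zero] at h1
    have h2 : v (c i₀) ≠ 0 := (lt_of_le_of_lt zero_le hi₀).ne'
    exact h2 h1.symm
  have hle : ∀ i, v (c i) ≤ v (c j) := by
    intro i
    rw [← hquot i]
    calc wB _ * v (c j) ≤ 1 * v (c j) := mul_le_mul_left (hwB1 _) _
      _ = v (c j) := one_mul _
  have hvg' : v g < v (c j) := lt_of_lt_of_le hi₀ (hle i₀)
  have hJ : ∀ x ∈ Ideal.span (Set.range c), v x ≤ v (c j) :=
    forall_mem_span_le v hR (by rintro _ ⟨i, rfl⟩; exact hle i)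
  -- `wB` is THE chart valuation `w` of p563432, so `θ⁻¹ 𝔪 = 𝔓_v`
  obtain ⟨w, hw⟩ := exists_valuation_away v ha
  have hwBw : ∀ z, wB z = w (z : Localization.Away (c j)) := valuation_blowupAlgebra_unique v hw ha hwBalg
  let 𝔓 : Ideal (blowupAlgebra (Ideal.span (Set.range c)) (c j)) :=
    (maximalIdeal (X'.presheaf.stalk x')).comap θ
  have h𝔓 : ∀ z : blowupAlgebra (Ideal.span (Set.range c)) (c j), z ∈ 𝔓 ↔ w (z : Localization.Away (c j)) < 1 := by
    intro z
    rw [Ideal.mem_comap, ← hwBlt, hwBw]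
  -- the K-RIBBON-BAD hypotheses for `𝔓` (p563432) and the ring form (p557704)
  have hM := (comap_centre_eq_maximalIdeal v hw h𝔓 hcent').2
  have hw' := (algebraMap_mem_centre_mul_span_iff v hw h𝔓 ha hg).mpr hvg'
  have hbad := RibbonBad.algebraMap_mem_sq (hc𝔪 j) hrib 𝔓 hM hw'
  -- transport along `θ`: `θ(𝔓) ⊆ 𝔪_{x′}`, `θ(ϖ/1) = π^♯ ϖ = germ of ϖ at x′`
  have hθP : 𝔓.map θ ≤ maximalIdeal (X'.presheaf.stalk x') := by
    rw [Ideal.map_le_iff_le_comap]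
  have key : θ (algebraMap (X.presheaf.stalk (π x')) (blowupAlgebra (Ideal.span (Set.range c)) (c j))
      ((X.presheaf.Γgerm (π x')).hom (r.appTop.hom ((Scheme.ΓSpecIso (.of O)).inv.hom ϖ)))) ∈
      (maximalIdeal (X'.presheaf.stalk x')) ^ 2 := by
    have hle2 : (𝔓 ^ 2).map θ ≤ (maximalIdeal (X'.presheaf.stalk x')) ^ 2 := by
      rw [Ideal.map_pow]
      exact Ideal.pow_right_mono hθP 2
    exact hle2 (Ideal.mem_map_of_mem θ hbad)
  rw [hθ] at key
  rw [varpiGerm_comp r (π ≫ r) π rfl x' ϖ]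
  exact key

end ValChartCentre

end Summit.ResolutionOfSingularities.ResolutionOfSingularities.Cruxes.EquisingularLiftNat.Sections
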